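import Summits.Ventures.QEC.Census.CertCoverBatch
import Summits.Ventures.QEC.Census.BB.A1s_n192_k8_c5e2eaee.CoreDefs
import HarnessLib

set_option Elab.async false
set_option maxRecDepth 200000

/-!
# `[[192,8,16]]` one-level cover certificate of `A1s_n192_k8_c5e2eaee` — LEVEL-1→0 coset problems 117…143 (deep problems [2] excluded: `ProbDeep*.lean`) as COMPACT data
(`ProbData`: U, f, σ, y₀, allow; qec-type-10 `CertCoverBatch.mkCoset` rebuilds each `CosetProb` in the kernel) + their verdict
`probsOK cov covR hx hx1 D1 lxd 14` (one `decide +kernel`; 27 problems, depths f=0:23 f=1:4 f=2:0 f=3:0, est. 112.5 s).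
qec-search-1 g5 (pattern of search-9 g5 `Probs*`); data from JSON `level10.problems` (sha256 53eedb194d9e6324…). Data + decided check; KERNEL.
-/

namespace Summit.Ventures.QEC.Census.A1s_n192_k8_c5e2eaee

open Matrix Summit.Ventures.QEC.Census Literature.InformationTheory.QuantumCodes

/-- Problems 117…143 (27): `⟨U, f, σ, y₀, allow⟩`. -/
def probs02b : List ProbData := [
    ⟨14511833066901392475553825, 1, 70381633274624, 70368748371968, [0]⟩,
    ⟨14512431802105644296880640, 0, 70368744177689, 4840434949378217649323008, []⟩,
    ⟨14587985054145539924475908, 0, 70368744177689, 4915988201418113813790212, []⟩,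
    ⟨19347720020149725267756128, 0, 70374133858401, 334267092730880, []⟩,
    ⟨19349897529657014192703524, 0, 70368765149984, 281474980904960, [0]⟩,
    ⟨19351078119870285870138400, 1, 70368744178432, 19346354888696287753012224, [0]⟩,
    ⟨19499246126524168137162752, 0, 70368744178539, 1883389952, []⟩,
    ⟨19652132766216497037050112, 0, 70375991934992, 306953821421712452040704, []⟩,
    ⟨21765535891456289696792576, 0, 70368744178474, 541163520, []⟩,
    ⟨22976674987111048299021344, 0, 70371965403144, 19345174297093162523558912, [0]⟩,
    ⟨24185609246453788171158528, 0, 70368744177689, 4840434949378217649323008, []⟩,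
    ⟨39294959226672636097470472, 0, 70394916635392, 39294811652577111919165448, []⟩,
    ⟨40503811259310966138994760, 0, 70394916635392, 39290162924592483227107384, []⟩,
    ⟨58108734272586070418784800, 0, 70368744178432, 4194304, [0]⟩,
    ⟨58637736164073855241949188, 1, 70368744178432, 4194304, [0]⟩,
    ⟨77829470443665239733964832, 0, 70369209746177, 77371400029291330762969088, [0]⟩,
    ⟨77980549277626724103225344, 0, 70368807093088, 77980549276782299168899072, [0]⟩,
    ⟨77980585456592565240340480, 0, 70394916635392, 77980437882497041062035456, []⟩,
    ⟨78585196951272055990403184, 0, 70369549484801, 295147909581431390208, []⟩,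
    ⟨78586156181981476639744176, 0, 70372770709513, 78584901803380067367468144, []⟩,
    ⟨79795303362524994624045168, 0, 70372770709513, 2422575167662832979164288, []⟩,
    ⟨155049904338474633637396512, 0, 70369146831171, 155049459310771624022245408, []⟩,
    ⟨155050053941296682350149632, 0, 70368744179524, 155049459033800240513941504, []⟩,
    ⟨155050658495644129918264352, 0, 70394513981637, 1199182479980539069440, []⟩,
    ⟨155351840645477509657264160, 0, 70369415266689, 155351690765675281349476384, []⟩,
    ⟨155956449411111914276143200, 0, 70369549484801, 295147909581431390208, []⟩,
    ⟨310698954312777266429444160, 1, 70369549484801, 295147909581431390208, []⟩]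

set_option maxHeartbeats 400000000 in
/-- Every problem of this chunk passes (`mkCoset` elimination + `cosetOKD` + fast `σ` + depth + `BU`-evenness + label checks). -/
theorem probs02b_ok : probsOK A1s_n192_k8_c5e2eaee.cov covR hx hx1 D1 lxd 14 probs02b = true := by
  decide +kernel

/-- Pointwise form. -/
theorem probs02b_all : ∀ x ∈ probs02b, probOK A1s_n192_k8_c5e2eaee.cov covR hx hx1 D1 lxd 14 x = true := by
  have h := probs02b_ok
  rwa [probsOK, List.all_eq_true] at h

end Summit.Ventures.QEC.Census.A1s_n192_k8_c5e2eaee
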